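import Summits.QuantumFields.BalabanUV.Beta.GAN24.CapacitanceRateDictionary
import Summits.QuantumFields.BalabanUV.Beta.GAN24.CapacitanceScalarRateSum

/-!
# `BalabanUV.Beta.GAN24.CapacitanceRateScaled` — binder row G-an2-4 / (CONV-C), road P1-fibre, leaf **P1-L11** `FibreRate` (Part B), PART 3/3 of the
# «L11 CAPACITANCE HALF»: the TWO-SCALE RATES `(Cap_{N'}⁻¹ − Cap_N⁻¹)` of the unit-normalised inverse blocks, `1 ≤ N ≤ N'`, constants displayed

NOT IN PRINT; OUR PROOF ATTEMPT.  HONEST FRAMING (cell contract, verbatim): «discharging `BetaPertH` makes Bałaban's UV stability UNCONDITIONAL — a real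
constructive-QFT result; it is NOT the continuum limit and NOT the Clay problem.»  HONEST DEPENDENCY (verbatim): «continuum YM on T⁴ ⇐ BetaPertH ∧ nine spine
estimates (0/9 proved); BetaPertH ⇐ (D1) ∧ (D4) ∧ CAP+tail; G-an2-4 gates asym, D1 and NE2/3/4.»  [folklore] assembly: part 1/3's abstract rates fed with leaf-07's landed scalar rates
(`CapacitanceScalarRateSum.aT_rate/sT_rate`, typer row P1-Y11s) and part 2/3's N-uniform unit-normalised bounds; no cited fact, no wall binder, no `def … : Prop`
hypothesis, no cancellation; 3 `def`s = explicit constants.  NOT summit progress: it discharges NOTHING of (CONV-C)'s K-slot `GAN24.CombesThomas.ConvCK 3 Lc` by itself (this is one input of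
row L11 = shape (I2′) of the carver's ASSEMBLY.md §II.3; L10 = (I3′) and L12 are separate); 0 wall binders instantiated; NOT `BetaPertH`, NOT continuum, NOT Clay.
Unit `b2b-balaban-gan24-formalise-leaf-20` (G-an2-4 formalisation swarm, leaf prover 20), 2026-08-20.  Value = kernel assembly leaf toward the K-slot route P1,
NOT summit progress.

## What is proved (every `D`; all levels `1 ≤ N ≤ N'`; every `q ∈ [−π, π]^D ∖ {0}`, `p = ofRealVec q`, `P = |q|² = momSq q`; `δ = dhat p`, `δ' = dflat p`)
With `r = π²/4`, `G = gFac D (Dπ²)` (L08), `rateA/rateS` (Y11s): DISPLAYED CONSTANTS `crPP D = rateA·(4r^{2D+2} + 16r^{3D+4}G + 16D·r^{4D+6}G²)`,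
`crPc D = 4·rateA·r^{3D+3}G + 2·rateS·r^{3D+2}(Dπ² + 1)G + 8D·rateA·r^{4D+5}G²`, `crcc D = rateS·r^{2D}(Dπ² + 1)/2 + 2·rateS·r^{3D+1}(Dπ² + 1)G + 4D·rateA·r^{4D+4}G²`,
and the RATES of the unit-normalised blocks between levels `N ≤ N'` at the same label `q`:
  **`‖invPP (↑ã^{(N')}) δ δ' κ l − invPP (↑ã^{(N)}) δ δ' κ l‖ ≤ crPP D·P²/N²`**,  **`‖invPc' − invPc‖, ‖invcP' − invcP‖ ≤ crPc D·P²√P/N²`**,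
  **`‖invcc' − invcc‖ ≤ crcc D·P³/N²`**  (pure substitution `α = 2r^{D+1}P`, `ς = r^D P²`, `η = rG/P²`, `ε = √P`, `ρ = rateA/N²`, `τ = rateS(1 + 1/P)/N²`
  into part 1/3, `inst_PP/inst_Pc/inst_cc` + `gFac D P ≤ G`, `P ≤ Dπ²`), and IN UNITS on T00's matrix:
  **`‖N'^{D+4}·(cap N' p)⁻¹ (inl κ) (inl l) − N^{D+4}·(cap N p)⁻¹ (inl κ) (inl l)‖ ≤ crPP D·P²/N²`** and the three other blocks.  With `N = Lc^{j+1}`,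
  `N' = Lc^{j+2}` this is the geometric rate `θ^{j+1}`, `θ = Lc⁻²`, of SKELETON-P1 B3/B4 for the capacitance factor of every leg of `kFibClosed` — the
  p-orders `P²`, `P²√P`, `P³` exceed the block orders `P`, `P√P`, `P²` of L08 by one power of `P` (the `m = 0` pole is cancelled inside `aT_rate`).
-/

noncomputable section

open Complex Finset
open scoped BigOperators Real

namespace Summit.QuantumFields.BalabanUV.Beta.GAN24.CapacitanceRateScaled

open Literature.MathematicalPhysics.QuantumFieldTheory.Balaban1983to89.B4Strip (ofRealVec)
open Literature.MathematicalPhysics.QuantumFieldTheory.King1986 (momSq momSq_nonneg)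
open FibreSymbols (dhat dflat)
open CapacitanceClosedForm (hSum invPP invPc invcP invcc)
open CapacitanceScalarBounds (momSq_pos)
open CapacitanceScalarRateBox (aT sT)
open CapacitanceEndpointBlocks (gFac)
open CapacitanceRate (norm_invPP_sub_le norm_invPc_sub_le norm_invcP_sub_le norm_invcc_sub_le)
open CapacitanceRateDictionary (nonvanishing_aT norm_inv_aTC_le norm_inv_sTC_le norm_inv_hSum_aTC_le scaled_cap_inv_inl_inl
  scaled_cap_inv_inl_inr scaled_cap_inv_inr_inl scaled_cap_inv_inr_inr)
open AliasObjects (cap)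

variable {D : ℕ}

/-! ## §4 The two-scale rates of the unit-normalised blocks, constants displayed -/

section scaled
open CapacitanceScalarRateSum (rateA rateS aT_rate sT_rate)
open CapacitanceScalarRateTerm (Kc one_le_Kc)
open CapacitanceScalarDictionary (norm_dhat_ofRealVec_le_sqrt norm_dflat_ofRealVec_le_sqrt)
open CapacitanceEndpointBlocks (gFac_pos gFac_momSq_le)

/-- The `φφ` RATE CONSTANT `crPP D = rateA D·(4r^{2D+2} + 16r^{3D+4}·G + 16D·r^{4D+6}·G²)`, `r = π²/4`, `G = gFac D (Dπ²)`. -/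
def crPP (D : ℕ) : ℝ :=
  rateA D * (4 * (π ^ 2 / 4) ^ (2 * D + 2) + 16 * (π ^ 2 / 4) ^ (3 * D + 4) * gFac D (D * π ^ 2)
    + 16 * D * (π ^ 2 / 4) ^ (4 * D + 6) * gFac D (D * π ^ 2) ^ 2)

/-- The `φc`/`cφ` RATE CONSTANT `crPc D = 4·rateA·r^{3D+3}·G + 2·rateS·r^{3D+2}·(Dπ² + 1)·G + 8D·rateA·r^{4D+5}·G²`. -/
def crPc (D : ℕ) : ℝ :=
  4 * rateA D * (π ^ 2 / 4) ^ (3 * D + 3) * gFac D (D * π ^ 2) + 2 * rateS D * (π ^ 2 / 4) ^ (3 * D + 2) * (D * π ^ 2 + 1) * gFac D (D * π ^ 2)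
    + 8 * D * rateA D * (π ^ 2 / 4) ^ (4 * D + 5) * gFac D (D * π ^ 2) ^ 2

/-- The `cc` RATE CONSTANT `crcc D = rateS·r^{2D}·(Dπ² + 1)/2 + 2·rateS·r^{3D+1}·(Dπ² + 1)·G + 4D·rateA·r^{4D+4}·G²`. -/
def crcc (D : ℕ) : ℝ :=
  rateS D * (π ^ 2 / 4) ^ (2 * D) * (D * π ^ 2 + 1) / 2 + 2 * rateS D * (π ^ 2 / 4) ^ (3 * D + 1) * (D * π ^ 2 + 1) * gFac D (D * π ^ 2)
    + 4 * D * rateA D * (π ^ 2 / 4) ^ (4 * D + 4) * gFac D (D * π ^ 2) ^ 2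

/-- [folklore] `0 ≤ rateA D`. -/
theorem rateA_nonneg (D : ℕ) : 0 ≤ rateA D := by
  unfold CapacitanceScalarRateSum.rateA
  have := one_le_Kc D
  positivity

/-- [folklore] `0 ≤ rateS D`. -/
theorem rateS_nonneg (D : ℕ) : 0 ≤ rateS D := by
  unfold CapacitanceScalarRateSum.rateS
  have := one_le_Kc D
  positivity

/-- [folklore] Real algebra of the `φφ` instantiation. -/
theorem inst_PP (n : ℕ) {P N2 : ℝ} (r G A Dr : ℝ) (hP : P ≠ 0) (hN2 : N2 ≠ 0) :
    (2 * r ^ (n + 1) * P) ^ 2 * (A / N2)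
        + P * (2 * (2 * r ^ (n + 1) * P) ^ 3 * (A / N2) * (r * G / P ^ 2)
          + Dr * P * (2 * r ^ (n + 1) * P) ^ 4 * (A / N2) * (r * G / P ^ 2) ^ 2)
      = A * P ^ 2 / N2 * (4 * r ^ (2 * n + 2) + 16 * r ^ (3 * n + 4) * G + 16 * Dr * r ^ (4 * n + 6) * G ^ 2) := by
  field_simp
  ring

/-- [folklore] Real algebra of the `φc` instantiation. -/
theorem inst_Pc (n : ℕ) {P N2 : ℝ} (r G A S Dr s : ℝ) (hP : P ≠ 0) (hN2 : N2 ≠ 0) :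
    s * ((2 * r ^ (n + 1) * P) ^ 2 * (A / N2) * (r ^ n * P ^ 2) * (r * G / P ^ 2)
        + 2 * r ^ (n + 1) * P * (r ^ n * P ^ 2) ^ 2 * (S * (1 + 1 / P) / N2) * (r * G / P ^ 2)
        + Dr * P * (2 * r ^ (n + 1) * P) ^ 3 * (A / N2) * (r ^ n * P ^ 2) * (r * G / P ^ 2) ^ 2)
      = P ^ 2 * s / N2 * (4 * A * r ^ (3 * n + 3) * G + 2 * S * r ^ (3 * n + 2) * (P + 1) * G + 8 * Dr * A * r ^ (4 * n + 5) * G ^ 2) := by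
  field_simp
  ring

/-- [folklore] Real algebra of the `cc` instantiation. -/
theorem inst_cc (n : ℕ) {P N2 : ℝ} (r G A S Dr : ℝ) (hP : P ≠ 0) (hN2 : N2 ≠ 0) :
    (r ^ n * P ^ 2) ^ 2 * (S * (1 + 1 / P) / N2) / 2 + 2 * (r ^ n * P ^ 2) ^ 3 * (S * (1 + 1 / P) / N2) * (r * G / P ^ 2)
        + Dr * P * (2 * r ^ (n + 1) * P) ^ 2 * (A / N2) * (r ^ n * P ^ 2) ^ 2 * (r * G / P ^ 2) ^ 2
      = P ^ 3 / N2 * (S * r ^ (2 * n) * (P + 1) / 2 + 2 * S * r ^ (3 * n + 1) * (P + 1) * G + 4 * Dr * A * r ^ (4 * n + 4) * G ^ 2) := by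
  field_simp
  ring

variable {N N' : ℕ} [NeZero N] [NeZero N'] {q : Fin D → ℝ}

/-- [folklore] `|q|² ≤ Dπ²` on the Brillouin zone. -/
theorem momSq_le (hq : ∀ i, |q i| ≤ π) : momSq q ≤ D * π ^ 2 := by
  unfold momSq
  calc ∑ i, q i ^ 2 ≤ ∑ _i : Fin D, π ^ 2 :=
        Finset.sum_le_sum fun i _ => by rw [← sq_abs]; exact pow_le_pow_left₀ (abs_nonneg _) (hq i) 2
    _ = D * π ^ 2 := by simp

/-- [folklore] The rate of the unit-normalised diagonal scalar in `ℂ`: `‖↑ã^{(N')}_κ − ↑ã^{(N)}_κ‖ ≤ rateA D/N²` (leaf-07's `aT_rate` BY NAME). -/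
theorem norm_aTC_sub_le (hNN' : N ≤ N') (hq : ∀ i, |q i| ≤ π) (hq0 : q ≠ 0) (κ : Fin D) :
    ‖((aT N' q κ : ℝ) : ℂ) - ((aT N q κ : ℝ) : ℂ)‖ ≤ rateA D / (N : ℝ) ^ 2 := by
  rw [← Complex.ofReal_sub, Complex.norm_real, Real.norm_eq_abs]
  exact aT_rate hNN' hq hq0 κ

/-- [folklore] The rate of the unit-normalised border scalar in `ℂ`: `‖↑σ̃^{(N')} − ↑σ̃^{(N)}‖ ≤ rateS D·(1 + |q|⁻²)/N²` (leaf-07's `sT_rate`). -/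
theorem norm_sTC_sub_le (hNN' : N ≤ N') (hq : ∀ i, |q i| ≤ π) (hq0 : q ≠ 0) :
    ‖((sT N' q : ℝ) : ℂ) - ((sT N q : ℝ) : ℂ)‖ ≤ rateS D * (1 + 1 / momSq q) / (N : ℝ) ^ 2 := by
  rw [← Complex.ofReal_sub, Complex.norm_real, Real.norm_eq_abs]
  exact sT_rate hNN' hq hq0

/-- **TWO-SCALE RATE OF THE UNIT-NORMALISED `φφ` BLOCK** [folklore]: for `1 ≤ N ≤ N'`, `q ∈ [−π, π]^D ∖ {0}`,
`‖invPP (↑ã^{(N')}) δ δ' κ l − invPP (↑ã^{(N)}) δ δ' κ l‖ ≤ crPP D · |q|⁴/N²` (`δ = dhat p`, `δ' = dflat p`, `p = ofRealVec q`). -/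
theorem norm_invPP_aT_sub_le (hN : 1 ≤ N) (hNN' : N ≤ N') (hq : ∀ i, |q i| ≤ π) (hq0 : q ≠ 0) (κ l : Fin D) :
    ‖invPP (fun κ => ((aT N' q κ : ℝ) : ℂ)) (dhat (ofRealVec q)) (dflat (ofRealVec q)) κ l
        - invPP (fun κ => ((aT N q κ : ℝ) : ℂ)) (dhat (ofRealVec q)) (dflat (ofRealVec q)) κ l‖
      ≤ crPP D * momSq q ^ 2 / (N : ℝ) ^ 2 := by
  have hN' : 1 ≤ N' := hN.trans hNN'
  have hN0 : (0 : ℝ) < N := by exact_mod_cast hN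
  have hP := momSq_pos hq0
  obtain ⟨ha, -, hh⟩ := nonvanishing_aT hN hq hq0
  obtain ⟨ha', -, hh'⟩ := nonvanishing_aT hN' hq hq0
  have h := norm_invPP_sub_le (D := D) _ _ _ _ ha ha' hh hh' (norm_inv_aTC_le hN hq hq0) (norm_inv_aTC_le hN' hq hq0)
    (norm_dhat_ofRealVec_le_sqrt q) (norm_dflat_ofRealVec_le_sqrt q) (norm_inv_hSum_aTC_le hN hq hq0) (norm_inv_hSum_aTC_le hN' hq hq0)
    (norm_aTC_sub_le hNN' hq hq0) κ l
  rw [Real.sq_sqrt hP.le, inst_PP D (π ^ 2 / 4) (gFac D (momSq q)) (rateA D) D hP.ne' (by positivity)] at h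
  refine h.trans ?_
  rw [show crPP D * momSq q ^ 2 / (N : ℝ) ^ 2 = rateA D * momSq q ^ 2 / (N : ℝ) ^ 2
      * (4 * (π ^ 2 / 4) ^ (2 * D + 2) + 16 * (π ^ 2 / 4) ^ (3 * D + 4) * gFac D (D * π ^ 2)
        + 16 * D * (π ^ 2 / 4) ^ (4 * D + 6) * gFac D (D * π ^ 2) ^ 2) by unfold crPP; ring]
  have hG := gFac_momSq_le (D := D) hq
  have hG0 : 0 ≤ gFac D (momSq q) := (gFac_pos D hP.le).le
  have hG2 : gFac D (momSq q) ^ 2 ≤ gFac D (D * π ^ 2) ^ 2 := pow_le_pow_left₀ hG0 hG 2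
  have hA := rateA_nonneg D
  refine mul_le_mul_of_nonneg_left ?_ (by positivity)
  have h1 := mul_le_mul_of_nonneg_left hG (by positivity : (0 : ℝ) ≤ 16 * (π ^ 2 / 4) ^ (3 * D + 4))
  have h2 := mul_le_mul_of_nonneg_left hG2 (by positivity : (0 : ℝ) ≤ 16 * D * (π ^ 2 / 4) ^ (4 * D + 6))
  linarith

/-- **TWO-SCALE RATE OF THE UNIT-NORMALISED `φc` COLUMN** [folklore]: `≤ crPc D · |q|⁴√|q|²/N²`. -/
theorem norm_invPc_aT_sub_le (hN : 1 ≤ N) (hNN' : N ≤ N') (hq : ∀ i, |q i| ≤ π) (hq0 : q ≠ 0) (κ : Fin D) :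
    ‖invPc (fun κ => ((aT N' q κ : ℝ) : ℂ)) (dhat (ofRealVec q)) (dflat (ofRealVec q)) (sT N' q : ℂ) κ
        - invPc (fun κ => ((aT N q κ : ℝ) : ℂ)) (dhat (ofRealVec q)) (dflat (ofRealVec q)) (sT N q : ℂ) κ‖
      ≤ crPc D * (momSq q ^ 2 * Real.sqrt (momSq q)) / (N : ℝ) ^ 2 := by
  have hN' : 1 ≤ N' := hN.trans hNN'
  have hN0 : (0 : ℝ) < N := by exact_mod_cast hN
  have hP := momSq_pos hq0
  obtain ⟨ha, hσ, hh⟩ := nonvanishing_aT hN hq hq0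
  obtain ⟨ha', hσ', hh'⟩ := nonvanishing_aT hN' hq hq0
  have h := norm_invPc_sub_le (D := D) _ _ _ _ _ _ ha ha' hσ hσ' hh hh' (norm_inv_aTC_le hN hq hq0) (norm_inv_aTC_le hN' hq hq0)
    (norm_dhat_ofRealVec_le_sqrt q) (norm_dflat_ofRealVec_le_sqrt q) (norm_inv_sTC_le hN hq hq0) (norm_inv_sTC_le hN' hq hq0)
    (norm_inv_hSum_aTC_le hN hq hq0) (norm_inv_hSum_aTC_le hN' hq hq0) (norm_aTC_sub_le hNN' hq hq0) (norm_sTC_sub_le hNN' hq hq0) κ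
  rw [Real.sq_sqrt hP.le, inst_Pc D (π ^ 2 / 4) (gFac D (momSq q)) (rateA D) (rateS D) D (Real.sqrt (momSq q)) hP.ne' (by positivity)] at h
  refine h.trans ?_
  rw [show crPc D * (momSq q ^ 2 * Real.sqrt (momSq q)) / (N : ℝ) ^ 2 = momSq q ^ 2 * Real.sqrt (momSq q) / (N : ℝ) ^ 2
      * (4 * rateA D * (π ^ 2 / 4) ^ (3 * D + 3) * gFac D (D * π ^ 2)
        + 2 * rateS D * (π ^ 2 / 4) ^ (3 * D + 2) * (D * π ^ 2 + 1) * gFac D (D * π ^ 2)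
        + 8 * D * rateA D * (π ^ 2 / 4) ^ (4 * D + 5) * gFac D (D * π ^ 2) ^ 2) by unfold crPc; ring]
  have hG := gFac_momSq_le (D := D) hq
  have hG0 : 0 ≤ gFac D (momSq q) := (gFac_pos D hP.le).le
  have hG2 : gFac D (momSq q) ^ 2 ≤ gFac D (D * π ^ 2) ^ 2 := pow_le_pow_left₀ hG0 hG 2
  have hA := rateA_nonneg D
  have hS := rateS_nonneg D
  have hPm := momSq_le hq
  refine mul_le_mul_of_nonneg_left ?_ (by positivity)
  have h1 := mul_le_mul_of_nonneg_left hG (by positivity : (0 : ℝ) ≤ 4 * rateA D * (π ^ 2 / 4) ^ (3 * D + 3))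
  have h2 : 2 * rateS D * (π ^ 2 / 4) ^ (3 * D + 2) * (momSq q + 1) * gFac D (momSq q)
      ≤ 2 * rateS D * (π ^ 2 / 4) ^ (3 * D + 2) * (D * π ^ 2 + 1) * gFac D (D * π ^ 2) :=
    mul_le_mul (mul_le_mul_of_nonneg_left (by linarith) (by positivity)) hG hG0 (by positivity)
  have h3 := mul_le_mul_of_nonneg_left hG2 (by positivity : (0 : ℝ) ≤ 8 * D * rateA D * (π ^ 2 / 4) ^ (4 * D + 5))
  linarith

/-- **TWO-SCALE RATE OF THE UNIT-NORMALISED `cφ` ROW** [folklore]: `≤ crPc D · |q|⁴√|q|²/N²`. -/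
theorem norm_invcP_aT_sub_le (hN : 1 ≤ N) (hNN' : N ≤ N') (hq : ∀ i, |q i| ≤ π) (hq0 : q ≠ 0) (l : Fin D) :
    ‖invcP (fun κ => ((aT N' q κ : ℝ) : ℂ)) (dhat (ofRealVec q)) (dflat (ofRealVec q)) (sT N' q : ℂ) l
        - invcP (fun κ => ((aT N q κ : ℝ) : ℂ)) (dhat (ofRealVec q)) (dflat (ofRealVec q)) (sT N q : ℂ) l‖
      ≤ crPc D * (momSq q ^ 2 * Real.sqrt (momSq q)) / (N : ℝ) ^ 2 := by
  have hN' : 1 ≤ N' := hN.trans hNN'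
  have hN0 : (0 : ℝ) < N := by exact_mod_cast hN
  have hP := momSq_pos hq0
  obtain ⟨ha, hσ, hh⟩ := nonvanishing_aT hN hq hq0
  obtain ⟨ha', hσ', hh'⟩ := nonvanishing_aT hN' hq hq0
  have h := norm_invcP_sub_le (D := D) _ _ _ _ _ _ ha ha' hσ hσ' hh hh' (norm_inv_aTC_le hN hq hq0) (norm_inv_aTC_le hN' hq hq0)
    (norm_dhat_ofRealVec_le_sqrt q) (norm_dflat_ofRealVec_le_sqrt q) (norm_inv_sTC_le hN hq hq0) (norm_inv_sTC_le hN' hq hq0)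
    (norm_inv_hSum_aTC_le hN hq hq0) (norm_inv_hSum_aTC_le hN' hq hq0) (norm_aTC_sub_le hNN' hq hq0) (norm_sTC_sub_le hNN' hq hq0) l
  rw [Real.sq_sqrt hP.le, inst_Pc D (π ^ 2 / 4) (gFac D (momSq q)) (rateA D) (rateS D) D (Real.sqrt (momSq q)) hP.ne' (by positivity)] at h
  refine h.trans ?_
  rw [show crPc D * (momSq q ^ 2 * Real.sqrt (momSq q)) / (N : ℝ) ^ 2 = momSq q ^ 2 * Real.sqrt (momSq q) / (N : ℝ) ^ 2
      * (4 * rateA D * (π ^ 2 / 4) ^ (3 * D + 3) * gFac D (D * π ^ 2)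
        + 2 * rateS D * (π ^ 2 / 4) ^ (3 * D + 2) * (D * π ^ 2 + 1) * gFac D (D * π ^ 2)
        + 8 * D * rateA D * (π ^ 2 / 4) ^ (4 * D + 5) * gFac D (D * π ^ 2) ^ 2) by unfold crPc; ring]
  have hG := gFac_momSq_le (D := D) hq
  have hG0 : 0 ≤ gFac D (momSq q) := (gFac_pos D hP.le).le
  have hG2 : gFac D (momSq q) ^ 2 ≤ gFac D (D * π ^ 2) ^ 2 := pow_le_pow_left₀ hG0 hG 2
  have hA := rateA_nonneg D
  have hS := rateS_nonneg D
  have hPm := momSq_le hq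
  refine mul_le_mul_of_nonneg_left ?_ (by positivity)
  have h1 := mul_le_mul_of_nonneg_left hG (by positivity : (0 : ℝ) ≤ 4 * rateA D * (π ^ 2 / 4) ^ (3 * D + 3))
  have h2 : 2 * rateS D * (π ^ 2 / 4) ^ (3 * D + 2) * (momSq q + 1) * gFac D (momSq q)
      ≤ 2 * rateS D * (π ^ 2 / 4) ^ (3 * D + 2) * (D * π ^ 2 + 1) * gFac D (D * π ^ 2) :=
    mul_le_mul (mul_le_mul_of_nonneg_left (by linarith) (by positivity)) hG hG0 (by positivity)
  have h3 := mul_le_mul_of_nonneg_left hG2 (by positivity : (0 : ℝ) ≤ 8 * D * rateA D * (π ^ 2 / 4) ^ (4 * D + 5))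
  linarith

/-- **TWO-SCALE RATE OF THE UNIT-NORMALISED `cc` CORNER** [folklore] (no cancellation): `≤ crcc D · |q|⁶/N²`. -/
theorem norm_invcc_aT_sub_le (hN : 1 ≤ N) (hNN' : N ≤ N') (hq : ∀ i, |q i| ≤ π) (hq0 : q ≠ 0) :
    ‖invcc (fun κ => ((aT N' q κ : ℝ) : ℂ)) (dhat (ofRealVec q)) (dflat (ofRealVec q)) (sT N' q : ℂ)
        - invcc (fun κ => ((aT N q κ : ℝ) : ℂ)) (dhat (ofRealVec q)) (dflat (ofRealVec q)) (sT N q : ℂ)‖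
      ≤ crcc D * momSq q ^ 3 / (N : ℝ) ^ 2 := by
  have hN' : 1 ≤ N' := hN.trans hNN'
  have hN0 : (0 : ℝ) < N := by exact_mod_cast hN
  have hP := momSq_pos hq0
  obtain ⟨ha, hσ, hh⟩ := nonvanishing_aT hN hq hq0
  obtain ⟨ha', hσ', hh'⟩ := nonvanishing_aT hN' hq hq0
  have h := norm_invcc_sub_le (D := D) _ _ _ _ _ _ ha ha' hσ hσ' hh hh' (norm_inv_aTC_le hN hq hq0) (norm_inv_aTC_le hN' hq hq0)
    (norm_dhat_ofRealVec_le_sqrt q) (norm_dflat_ofRealVec_le_sqrt q) (norm_inv_sTC_le hN hq hq0) (norm_inv_sTC_le hN' hq hq0)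
    (norm_inv_hSum_aTC_le hN hq hq0) (norm_inv_hSum_aTC_le hN' hq hq0) (norm_aTC_sub_le hNN' hq hq0) (norm_sTC_sub_le hNN' hq hq0)
  rw [Real.sq_sqrt hP.le, inst_cc D (π ^ 2 / 4) (gFac D (momSq q)) (rateA D) (rateS D) D hP.ne' (by positivity)] at h
  refine h.trans ?_
  rw [show crcc D * momSq q ^ 3 / (N : ℝ) ^ 2 = momSq q ^ 3 / (N : ℝ) ^ 2
      * (rateS D * (π ^ 2 / 4) ^ (2 * D) * (D * π ^ 2 + 1) / 2
        + 2 * rateS D * (π ^ 2 / 4) ^ (3 * D + 1) * (D * π ^ 2 + 1) * gFac D (D * π ^ 2)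
        + 4 * D * rateA D * (π ^ 2 / 4) ^ (4 * D + 4) * gFac D (D * π ^ 2) ^ 2) by unfold crcc; ring]
  have hG := gFac_momSq_le (D := D) hq
  have hG0 : 0 ≤ gFac D (momSq q) := (gFac_pos D hP.le).le
  have hG2 : gFac D (momSq q) ^ 2 ≤ gFac D (D * π ^ 2) ^ 2 := pow_le_pow_left₀ hG0 hG 2
  have hA := rateA_nonneg D
  have hS := rateS_nonneg D
  have hPm := momSq_le hq
  refine mul_le_mul_of_nonneg_left ?_ (by positivity)
  have h1 : rateS D * (π ^ 2 / 4) ^ (2 * D) * (momSq q + 1) / 2 ≤ rateS D * (π ^ 2 / 4) ^ (2 * D) * (D * π ^ 2 + 1) / 2 :=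
    div_le_div_of_nonneg_right (mul_le_mul_of_nonneg_left (by linarith) (by positivity)) zero_le_two
  have h2 : 2 * rateS D * (π ^ 2 / 4) ^ (3 * D + 1) * (momSq q + 1) * gFac D (momSq q)
      ≤ 2 * rateS D * (π ^ 2 / 4) ^ (3 * D + 1) * (D * π ^ 2 + 1) * gFac D (D * π ^ 2) :=
    mul_le_mul (mul_le_mul_of_nonneg_left (by linarith) (by positivity)) hG hG0 (by positivity)
  have h3 := mul_le_mul_of_nonneg_left hG2 (by positivity : (0 : ℝ) ≤ 4 * D * rateA D * (π ^ 2 / 4) ^ (4 * D + 4))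
  linarith

/-- **`(Cap_{j+1}⁻¹ − Cap_j⁻¹)`-RATE, `φφ` BLOCK, in units** [folklore]: for `1 ≤ N ≤ N'` and `q ∈ [−π, π]^D ∖ {0}` (`p = ofRealVec q`),
`‖N'^{D+4}·(cap N' p)⁻¹ (inl κ) (inl l) − N^{D+4}·(cap N p)⁻¹ (inl κ) (inl l)‖ ≤ crPP D · |q|⁴/N²`. -/
theorem scaled_cap_inv_inl_inl_rate (hN : 1 ≤ N) (hNN' : N ≤ N') (hq : ∀ i, |q i| ≤ π) (hq0 : q ≠ 0) (κ l : Fin D) :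
    ‖(N' : ℂ) ^ (D + 4) * (cap N' (ofRealVec q))⁻¹ (Sum.inl κ) (Sum.inl l) - (N : ℂ) ^ (D + 4) * (cap N (ofRealVec q))⁻¹ (Sum.inl κ) (Sum.inl l)‖
      ≤ crPP D * momSq q ^ 2 / (N : ℝ) ^ 2 := by
  rw [scaled_cap_inv_inl_inl (hN.trans hNN') hq hq0, scaled_cap_inv_inl_inl hN hq hq0]
  exact norm_invPP_aT_sub_le hN hNN' hq hq0 κ l

/-- **`φc` COLUMN RATE, in units** [folklore]: `≤ crPc D · |q|⁴√|q|²/N²`. -/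
theorem scaled_cap_inv_inl_inr_rate (hN : 1 ≤ N) (hNN' : N ≤ N') (hq : ∀ i, |q i| ≤ π) (hq0 : q ≠ 0) (κ : Fin D) (u : Unit) :
    ‖(N' : ℂ) ^ (D + 4) * (cap N' (ofRealVec q))⁻¹ (Sum.inl κ) (Sum.inr u) - (N : ℂ) ^ (D + 4) * (cap N (ofRealVec q))⁻¹ (Sum.inl κ) (Sum.inr u)‖
      ≤ crPc D * (momSq q ^ 2 * Real.sqrt (momSq q)) / (N : ℝ) ^ 2 := by
  rw [scaled_cap_inv_inl_inr (hN.trans hNN') hq hq0, scaled_cap_inv_inl_inr hN hq hq0]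
  exact norm_invPc_aT_sub_le hN hNN' hq hq0 κ

/-- **`cφ` ROW RATE, in units** [folklore]: `≤ crPc D · |q|⁴√|q|²/N²`. -/
theorem scaled_cap_inv_inr_inl_rate (hN : 1 ≤ N) (hNN' : N ≤ N') (hq : ∀ i, |q i| ≤ π) (hq0 : q ≠ 0) (u : Unit) (l : Fin D) :
    ‖(N' : ℂ) ^ (D + 4) * (cap N' (ofRealVec q))⁻¹ (Sum.inr u) (Sum.inl l) - (N : ℂ) ^ (D + 4) * (cap N (ofRealVec q))⁻¹ (Sum.inr u) (Sum.inl l)‖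
      ≤ crPc D * (momSq q ^ 2 * Real.sqrt (momSq q)) / (N : ℝ) ^ 2 := by
  rw [scaled_cap_inv_inr_inl (hN.trans hNN') hq hq0, scaled_cap_inv_inr_inl hN hq hq0]
  exact norm_invcP_aT_sub_le hN hNN' hq hq0 l

/-- **`cc` CORNER RATE, in units** [folklore] (no cancellation): `≤ crcc D · |q|⁶/N²`. -/
theorem scaled_cap_inv_inr_inr_rate (hN : 1 ≤ N) (hNN' : N ≤ N') (hq : ∀ i, |q i| ≤ π) (hq0 : q ≠ 0) (u u' : Unit) :
    ‖(N' : ℂ) ^ (D + 4) * (cap N' (ofRealVec q))⁻¹ (Sum.inr u) (Sum.inr u') - (N : ℂ) ^ (D + 4) * (cap N (ofRealVec q))⁻¹ (Sum.inr u) (Sum.inr u')‖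
      ≤ crcc D * momSq q ^ 3 / (N : ℝ) ^ 2 := by
  rw [scaled_cap_inv_inr_inr (hN.trans hNN') hq hq0, scaled_cap_inv_inr_inr hN hq hq0]
  exact norm_invcc_aT_sub_le hN hNN' hq hq0

end scaled

end Summit.QuantumFields.BalabanUV.Beta.GAN24.CapacitanceRateScaled

end
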